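import Summits.Langlands.Langlands.Theses.ParityBlindBianchi
import Summits.Langlands.Langlands.Theorems.IcosahedralDescentLevel.Negative.AllParityOfDoorOfDescent
import Literature.NumberTheory.Automorphic.StrongArtinGL2
import Literature.NumberTheory.GaloisRepresentations.ArtinRestriction
import Literature.FieldTheory.AlgClosed.PadicAlgClEquivComplex
import Literature.NumberTheory.Automorphic.LanglandsTetrahedral

/-!
# `IcosahedralDescentLevel` (stmt-Langlands-15113): the `S₀ ∋ 0` door needs no modularity input,
# and the repair `0 ∉ S₀` is complete

Negative-side lemmas (refuter, cdisprove cycle 1, 2026-08-16; supports stmt-Langlands-15113),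
sharpening `Negative.allParity_of_door_of_descent` (p90502), which fed the door with the residual
crux E1′ `ResidualBianchiDoorLevel`.

* `exists_entrywise_twoAdicModel` — the "2-adic model" clause of D′/E1′ is FREE: for every
  `ι : ℚ̄₂ ≃+* ℂ`, every `ρ : Γ_ℚ →ₜ* GL₂(ℂ)` and every number field `K` there IS a framed
  `σ : Γ_K →ₜ* GL₂(ℚ̄₂)` with `ι ∘ σ = ρ|_{Γ_K}` entrywise (finite image ⇒ open kernel ⇒ the
  transport along the discontinuous `ι⁻¹` is still continuous).
* `allParity_of_descent_of_inhabited` — hence `IcosahedralDescentLevel` AS TYPED, together with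
  the bare existence of ONE cuspidal automorphic representation datum of `GL₂` over each 2-split
  imaginary quadratic field (true; not constructible in the tree), already yields strong Artin
  (a.e.) for EVERY irreducible icosahedral `ρ/ℚ`, odd or even — in particular the route's open
  rank-0 target `EvenIcosahedralStrongArtin` with its evenness hypothesis deleted.
* `icosahedralDescentLevel_iff_repaired_and_door` — the EXACT decomposition
  `D′ ↔ (D′ with 0 ∉ S₀) ∧ (the door)`: the planner's restatement `∃ S₀, 0 ∉ S₀ ∧ …` loses
  nothing and no further defect hides in the typing (the second conjunct is the all-parity
  statement above, relative to the per-`K` data).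

No statement of the route is asserted: every conclusion is either all-parity Artin (not a route
decl: no parity hypothesis) or an equivalence.
-/

-- `Summit.Langlands.Langlands.…`: the repeated path component is the tree's layout (D-0017).
set_option linter.dupNamespace false

namespace Summit.Langlands.Langlands.Theorems.IcosahedralDescentLevel.Negative

open scoped MatrixGroups NumberField
open NumberField IsDedekindDomain Field Filter
open Literature.NumberTheory.Automorphic Literature.NumberTheory.GaloisRepresentations
open Summit.Langlands.Langlands.Theses.ParityBlindBianchi

/-- **2-adic models exist, unconditionally.** For every `ι : ℚ̄₂ ≃+* ℂ`, every
`ρ : Γ_ℚ →ₜ* GL₂(ℂ)` and every number field `K`, the entrywise transport `σ := ι⁻¹ ∘ ρ|_{Γ_K}` is a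
framed 2-adic Galois representation: `ρ|_{Γ_K}` has finite image (`finite_range_toMonoidHom`),
hence open kernel (`isOpen_ker_of_finite_range`), and a homomorphism whose kernel contains an open
subgroup is continuous (`MonoidHom.continuous_of_isOpen_ker`, `LanglandsTetrahedral`). So the model
clause `∀ g i j, ι ((σ g) i j) = (ρ|_K g) i j` of
`IcosahedralDescentLevel` / `ResidualBianchiDoorLevel` constrains nothing. [folklore] -/
theorem exists_entrywise_twoAdicModel (ι : PadicAlgCl 2 ≃+* ℂ) (ρ : FramedGaloisRep ℚ ℂ 2)
    (K : Type) [Field K] [NumberField K] :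
    ∃ σ : FramedGaloisRep K (PadicAlgCl 2) 2, ∀ (g : absoluteGaloisGroup K) (i j : Fin 2),
      ι ((σ g).val i j) = ((FramedGaloisRep.restrictField K ρ) g).val i j := by
  set ρK : FramedArtinRep K 2 := FramedGaloisRep.restrictField K ρ
  haveI : Finite ρK.toMonoidHom.range := finite_range_toMonoidHom ρK
  have hker : IsOpen (ρK.toMonoidHom.ker : Set (absoluteGaloisGroup K)) :=
    isOpen_ker_of_finite_range ρK
  let f : absoluteGaloisGroup K →* GL (Fin 2) (PadicAlgCl 2) :=
    (Matrix.GeneralLinearGroup.map (ι.symm : ℂ →+* PadicAlgCl 2)).comp ρK.toMonoidHom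
  have hle : ρK.toMonoidHom.ker ≤ f.ker := by
    intro g hg
    rw [MonoidHom.mem_ker] at hg ⊢
    have hg' : ρK g = 1 := hg
    change Matrix.GeneralLinearGroup.map (ι.symm : ℂ →+* PadicAlgCl 2) (ρK g) = 1
    rw [hg', map_one]
  have hfker : IsOpen (f.ker : Set (absoluteGaloisGroup K)) := Subgroup.isOpen_mono hle hker
  refine ⟨{ f with continuous_toFun := MonoidHom.continuous_of_isOpen_ker f hfker }, fun g i j => ?_⟩
  change ι ((f g).val i j) = _
  simp [f]

/-- **`IcosahedralDescentLevel` as typed + bare cuspidal inhabitation ⟹ all-parity icosahedral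
strong Artin over `ℚ`.** If D′ holds and, for every imaginary quadratic `K` with `2` split, SOME
cuspidal automorphic representation datum of `GL₂(𝔸_K)` exists, then every irreducible
`ρ : Γ_ℚ →ₜ* GL₂(ℂ)` with projective image `A₅` — NO parity hypothesis — has a cuspidal `π` on
`GL₂(𝔸_ℚ)` with `satakePolynomial (t_{π,v}) = charpoly ρ(Frob_v)` at cofinitely many `v`. Proof:
feed D′ with the junk bad set `S₀ = {0}` (no good places, `no_good_place_of_zero_mem`), the free
2-adic models (`exists_entrywise_twoAdicModel`) and the given cuspidal data; `ι` exists by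
Steinitz (`PadicAlgCl.nonempty_ringEquiv_complex`). Sharpens p90502 (no E1′, no Hecke point, no
weight realisation: only the existence of one cusp form per field separates the typed D′ from the
open even icosahedral Artin conjecture). [folklore] -/
theorem allParity_of_descent_of_inhabited (hD : IcosahedralDescentLevel)
    (hinh : ∀ (K : Type) [Field K] [NumberField K], NumberField.IsTotallyComplex K →
      Module.finrank ℚ K = 2 →
      (∃ v w : HeightOneSpectrum (𝓞 K), v ≠ w ∧ ((2 : ℕ) : 𝓞 K) ∈ v.asIdeal ∧
        ((2 : ℕ) : 𝓞 K) ∈ w.asIdeal) →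
      ∃ hcpt : isCompact_glFiniteIntegralLevel 2 K, Nonempty (CuspidalAutomorphicRepData 2 K hcpt))
    (ρ : FramedGaloisRep ℚ ℂ 2) (hirr : ρ.toGaloisRep.IsIrreducible)
    (hA5 : Nonempty ((Matrix.ProjGenLinGroup.mk.comp ρ.toMonoidHom).range ≃*
      alternatingGroup (Fin 5))) :
    ∃ (hcpt : isCompact_glFiniteIntegralLevel 2 ℚ) (π : CuspidalAutomorphicRepData 2 ℚ hcpt),
      ∀ᶠ v : HeightOneSpectrum (𝓞 ℚ) in cofinite, ∃ α : Multiset ℂ,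
        π.1.HasSatakeParamAt v α ∧ ρ.IsUnramifiedAt v ∧
          ρ.HasFrobCharpolyAt v (satakePolynomial α) := by
  obtain ⟨ι⟩ := PadicAlgCl.nonempty_ringEquiv_complex 2
  refine hD ι ρ hirr hA5 ⟨{0}, ?_⟩
  intro K _ _ htc hdeg hsplit
  obtain ⟨hcpt, ⟨π⟩⟩ := hinh K htc hdeg hsplit
  obtain ⟨σ, hσ⟩ := exists_entrywise_twoAdicModel ι ρ K
  refine ⟨σ, hcpt, π, hσ, fun w hw => ?_⟩
  exact absurd hw (no_good_place_of_zero_mem (Finset.mem_singleton_self 0) K w)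

/-- **Exact decomposition of the typed crux: `D′ ↔ D″ ∧ Door`.** `D″` is D′ with `0 ∉ S₀` added
to the existential over the bad set (the planner's repair; theorem-sized uniform quadratic
descent); `Door` is D′ specialised to bare per-field data (a 2-adic model and SOME cuspidal datum
for every 2-split imaginary quadratic `K`, no compatibility) — by `allParity_of_descent_of_inhabited`
and `exists_entrywise_twoAdicModel` the door is all-parity icosahedral strong Artin relative to
cuspidal inhabitation. (→) both are special cases (`S₀` with `0 ∉ S₀`; `S₀ = {0}`); (←) for a
witness `S₀` either `0 ∉ S₀` or the family itself supplies the bare data. Hence the repair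
`0 ∉ S₀` is COMPLETE: no further defect hides in the typing of D′. [folklore] -/
theorem icosahedralDescentLevel_iff_repaired_and_door :
    IcosahedralDescentLevel ↔
      ((∀ (ι : PadicAlgCl 2 ≃+* ℂ) (ρ : FramedGaloisRep ℚ ℂ 2), ρ.toGaloisRep.IsIrreducible →
        Nonempty ((Matrix.ProjGenLinGroup.mk.comp ρ.toMonoidHom).range ≃* alternatingGroup (Fin 5)) →
        (∃ S₀ : Finset ℕ, (0 : ℕ) ∉ S₀ ∧ ∀ (K : Type) [Field K] [NumberField K],
          NumberField.IsTotallyComplex K → Module.finrank ℚ K = 2 →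
          (∃ v w : HeightOneSpectrum (𝓞 K), v ≠ w ∧ ((2 : ℕ) : 𝓞 K) ∈ v.asIdeal ∧
            ((2 : ℕ) : 𝓞 K) ∈ w.asIdeal) →
          ∃ (σ : FramedGaloisRep K (PadicAlgCl 2) 2) (hcpt : isCompact_glFiniteIntegralLevel 2 K)
            (π : CuspidalAutomorphicRepData 2 K hcpt),
            (∀ (g : absoluteGaloisGroup K) (i j : Fin 2),
              ι ((σ g).val i j) = ((FramedGaloisRep.restrictField K ρ) g).val i j) ∧
            ∀ w : HeightOneSpectrum (𝓞 K), (∀ ℓ ∈ S₀, ((ℓ : ℕ) : 𝓞 K) ∉ w.asIdeal) →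
              Summit.Langlands.SatakeFrobCompatibleAt ι π.1 σ w) →
        ∃ (hcpt : isCompact_glFiniteIntegralLevel 2 ℚ) (π : CuspidalAutomorphicRepData 2 ℚ hcpt),
          ∀ᶠ v : HeightOneSpectrum (𝓞 ℚ) in cofinite, ∃ α : Multiset ℂ,
            π.1.HasSatakeParamAt v α ∧ ρ.IsUnramifiedAt v ∧
              ρ.HasFrobCharpolyAt v (satakePolynomial α)) ∧
      (∀ (ι : PadicAlgCl 2 ≃+* ℂ) (ρ : FramedGaloisRep ℚ ℂ 2), ρ.toGaloisRep.IsIrreducible →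
        Nonempty ((Matrix.ProjGenLinGroup.mk.comp ρ.toMonoidHom).range ≃* alternatingGroup (Fin 5)) →
        (∀ (K : Type) [Field K] [NumberField K], NumberField.IsTotallyComplex K →
          Module.finrank ℚ K = 2 →
          (∃ v w : HeightOneSpectrum (𝓞 K), v ≠ w ∧ ((2 : ℕ) : 𝓞 K) ∈ v.asIdeal ∧
            ((2 : ℕ) : 𝓞 K) ∈ w.asIdeal) →
          ∃ (σ : FramedGaloisRep K (PadicAlgCl 2) 2) (hcpt : isCompact_glFiniteIntegralLevel 2 K)
            (_π : CuspidalAutomorphicRepData 2 K hcpt),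
            ∀ (g : absoluteGaloisGroup K) (i j : Fin 2),
              ι ((σ g).val i j) = ((FramedGaloisRep.restrictField K ρ) g).val i j) →
        ∃ (hcpt : isCompact_glFiniteIntegralLevel 2 ℚ) (π : CuspidalAutomorphicRepData 2 ℚ hcpt),
          ∀ᶠ v : HeightOneSpectrum (𝓞 ℚ) in cofinite, ∃ α : Multiset ℂ,
            π.1.HasSatakeParamAt v α ∧ ρ.IsUnramifiedAt v ∧
              ρ.HasFrobCharpolyAt v (satakePolynomial α))) := by
  constructor
  · intro h
    refine ⟨fun ι ρ hirr hA5 ⟨S₀, _, hS⟩ => h ι ρ hirr hA5 ⟨S₀, hS⟩, fun ι ρ hirr hA5 hdata => ?_⟩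
    refine h ι ρ hirr hA5 ⟨{0}, fun K _ _ htc hdeg hsplit => ?_⟩
    obtain ⟨σ, hcpt, π, hmodel⟩ := hdata K htc hdeg hsplit
    refine ⟨σ, hcpt, π, hmodel, fun w hw => ?_⟩
    exact absurd hw (no_good_place_of_zero_mem (Finset.mem_singleton_self 0) K w)
  · rintro ⟨hrep, hdoor⟩ ι ρ hirr hA5 ⟨S₀, hS⟩
    by_cases h0 : (0 : ℕ) ∈ S₀
    · refine hdoor ι ρ hirr hA5 fun K _ _ htc hdeg hsplit => ?_
      obtain ⟨σ, hcpt, π, hmodel, -⟩ := hS K htc hdeg hsplit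
      exact ⟨σ, hcpt, π, hmodel⟩
    · exact hrep ι ρ hirr hA5 ⟨S₀, h0, hS⟩

end Summit.Langlands.Langlands.Theorems.IcosahedralDescentLevel.Negative
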